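import Summits.KontsevichZagierPeriods.KontsevichZagierPeriods.Theses.Grothendieck
import Literature.NumberTheory.Transcendental.KZProductIdeal
import Literature.NumberTheory.Transcendental.KZIntervalPeriodProofs
import Literature.NumberTheory.Transcendental.KZCalculusProofs
import Literature.Analysis.SpecialFunctions.LemniscaticEllipticValuesProofs
import Literature.Probability.RandomPlanarGeometry.RectangleModulusElliptic

/-!
# `GpcLegendreLemniscatic` (stmt-KontsevichZagierPeriods-0280) — negative knowledge, part 1: the canonical pair

Support file for the crux `Grothendieck.GpcLegendreLemniscatic` (Legendre's relation
`2E(1/√2)K(1/√2) − K(1/√2)² = π/2` inside the Kontsevich–Zagier calculus; cdisprove seat, gen 1; work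
file `Cruxes/gpc_legendre_lemniscatic/Disproof.lean`). Contents:

* the two CANONICAL REPRESENTATIONS `legendreRep = [g]·[k] : IntegralRep 2` (`k`, `e` the
  `K(1/√2)`, `E(1/√2)` densities, `g = 2e − k = √(1−t²)/√(1−t²/2)`; the Fubini product
  `KZ.IntegralRep.prod` of two unit-interval representations) and `arctanRep = [ℝ, 1/(2(1+x²))]`,
  with their VALUES, both `π/2` (tree theorems `Lawden1989_eq_3_8_29_lemniscatic_holds`,
  `KZ.IntegralRep.value_prod`, Mathlib `integral_univ_inv_one_add_sq`) — so no evaluation invariant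
  separates them;
* the READBACK `cruxIntegrand_eq`: the crux's printed integrand (left-associated divisions) is
  `g(x₀)·k(x₁)` on `(0,1)²`;
* `equivalent_of_eqOn` (identity change of variables) and the REDUCTION `gpcLegendre_iff :
  GpcLegendreLemniscatic ↔ KZ.Equivalent legendreRep arctanRep` — the `∀ r r'` shape and off-domain
  values are harmless, the hypotheses are satisfiable (no vacuity); a prover may work with the
  canonical pair and import this file;
* `not_kontsevichZagierPeriods_of_not_gpcLegendre : ¬ crux → ¬ KontsevichZagierPeriods` — the
  crux is a CONSEQUENCE of the summit statement (tree theorem `KZ.exists_isRational_equivalent_holds`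
  + soundness + the value identity): a refutation of the crux would refute Conjecture 1 as typed.

Parts 2–3 (`LoadBearing`, `Strengthenings`) carry the load-bearing analysis, the necessity of a
Newton–Leibniz move, and the refuted strengthenings. [cite: Lawden1989, §3.8 eq. (3.8.29) and Ch. 3 Exercise 25]
-/

noncomputable section

open MeasureTheory Set
open Literature.NumberTheory.Transcendental
open Literature.NumberTheory.Transcendental.KZ
open Literature.ModelTheory.ExponentialFields (IsSemialgebraic)
open MvPolynomial (aeval X C)
open Summit.KontsevichZagierPeriods.KontsevichZagierPeriods.Theses.Grothendieck (GpcLegendreLemniscatic)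

namespace Summit.KontsevichZagierPeriods.Grothendieck.GpcLegendreLemniscaticNegative

/-! ## §1 Vocabulary: the canonical representations -/

/-- `k(t) = 1/√((1 − t²)(1 − t²/2))`, the `K(1/√2)` integrand. [cite: Lawden1989, §3.1 eq. (3.1.3)] -/
def kFun (t : ℝ) : ℝ := 1 / Real.sqrt ((1 - t ^ 2) * (1 - t ^ 2 / 2))

/-- `e(t) = √(1 − t²/2)/√(1 − t²)`, the `E(1/√2)` integrand. [cite: Lawden1989, §3.8 eq. (3.8.3)] -/
def eFun (t : ℝ) : ℝ := Real.sqrt (1 - t ^ 2 / 2) / Real.sqrt (1 - t ^ 2)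

/-- `g(t) = 2e(t) − k(t) = √(1 − t²)/√(1 − t²/2)` (on `(0,1)`), the first factor of the crux
integrand `(2e(x₀) − k(x₀))·k(x₁)`. [folklore] -/
def gFun (t : ℝ) : ℝ := Real.sqrt (1 - t ^ 2) / Real.sqrt (1 - t ^ 2 / 2)

/-- The open unit interval as a subset of `ℝ¹`. [folklore] -/
def unitIoo : Set (Fin 1 → ℝ) := {x | x 0 ∈ Ioo (0:ℝ) 1}

/-- `unitIoo` is `ℚ`-semialgebraic. [folklore] -/
theorem isSemialgebraic_unitIoo : IsSemialgebraic ℚ unitIoo :=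
  isSemialgebraic_unitInterval_fin_one

/-- `unitIoo` is the preimage of `(0,1)` under `ℝ¹ ≃ ℝ`. [folklore] -/
theorem unitIoo_eq_preimage : unitIoo = MeasurableEquiv.funUnique (Fin 1) ℝ ⁻¹' Ioo 0 1 := by
  ext x
  simp [unitIoo, MeasurableEquiv.funUnique, Fin.default_eq_zero]

/-- The one-dimensional representation `[(0,1), h]` of a semialgebraic integrable `h`. [folklore] -/
def unitRep (h : ℝ → ℝ) (hh : IsSemialgebraicFunOn ℚ unitIoo (fun x => h (x 0)))
    (hint : IntegrableOn h (Ioo 0 1)) : IntegralRep 1 where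
  domain := unitIoo
  integrand := fun x => h (x 0)
  isSemialgebraic_domain := isSemialgebraic_unitIoo
  isSemialgebraicFunOn_integrand := hh
  integrableOn := by
    rw [unitIoo_eq_preimage]
    exact ((volume_preserving_funUnique (Fin 1) ℝ).integrableOn_comp_preimage
      (MeasurableEquiv.measurableEmbedding _)).mpr hint

/-- The domain of `unitRep`. [folklore] -/
@[simp] theorem unitRep_domain (h : ℝ → ℝ) (hh : IsSemialgebraicFunOn ℚ unitIoo (fun x => h (x 0)))
    (hint : IntegrableOn h (Ioo 0 1)) : (unitRep h hh hint).domain = unitIoo := rfl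

/-- The integrand of `unitRep`. [folklore] -/
@[simp] theorem unitRep_integrand (h : ℝ → ℝ) (hh : IsSemialgebraicFunOn ℚ unitIoo (fun x => h (x 0)))
    (hint : IntegrableOn h (Ioo 0 1)) : (unitRep h hh hint).integrand = fun x => h (x 0) := rfl

/-- The value of `unitRep h` is `∫_{(0,1)} h`. [folklore] -/
theorem unitRep_value (h : ℝ → ℝ) (hh : IsSemialgebraicFunOn ℚ unitIoo (fun x => h (x 0)))
    (hint : IntegrableOn h (Ioo 0 1)) : (unitRep h hh hint).value = ∫ t in Ioo (0:ℝ) 1, h t := by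
  change ∫ x in unitIoo, h (x 0) = _
  rw [unitIoo_eq_preimage, ← (volume_preserving_funUnique (Fin 1) ℝ).setIntegral_preimage_emb
    (MeasurableEquiv.measurableEmbedding _) h (Ioo 0 1)]
  rfl

/-- The radicand `(1 − t²)(1 − t²/2)` is positive on `(0,1)`. [folklore] -/
theorem radicand_pos {t : ℝ} (ht : t ∈ Ioo (0:ℝ) 1) : 0 < (1 - t ^ 2) * (1 - t ^ 2 / 2) := by
  have h1 : 0 < 1 - t ^ 2 := by nlinarith [ht.1, ht.2]
  have h2 : 0 < 1 - t ^ 2 / 2 := by nlinarith [ht.1, ht.2]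
  exact mul_pos h1 h2

/-- `x ↦ 1 − x₀²` is semialgebraic on `unitIoo`. [folklore] -/
theorem isSemialgebraicFunOn_one_sub_sq :
    IsSemialgebraicFunOn ℚ unitIoo (fun x => 1 - x 0 ^ 2) := by
  have := isSemialgebraicFunOn_aeval isSemialgebraic_unitIoo (1 - X 0 ^ 2 : MvPolynomial (Fin 1) ℚ)
  refine this.congr fun x _ => ?_
  simp

/-- `x ↦ 1 − x₀²/2` is semialgebraic on `unitIoo`. [folklore] -/
theorem isSemialgebraicFunOn_one_sub_sq_half :
    IsSemialgebraicFunOn ℚ unitIoo (fun x => 1 - x 0 ^ 2 / 2) := by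
  have := isSemialgebraicFunOn_aeval isSemialgebraic_unitIoo
    (1 - X 0 ^ 2 * C (1 / 2 : ℚ) : MvPolynomial (Fin 1) ℚ)
  refine this.congr fun x _ => ?_
  simp only [map_sub, map_one, map_mul, map_pow, MvPolynomial.aeval_X, MvPolynomial.aeval_C,
    eq_ratCast]
  push_cast
  ring

/-- `x ↦ k(x₀)` is semialgebraic on `unitIoo`. [folklore] -/
theorem isSemialgebraicFunOn_kFun : IsSemialgebraicFunOn ℚ unitIoo (fun x => kFun (x 0)) := by
  have hp := IsSemialgebraicFunOn.mul_holds isSemialgebraicFunOn_one_sub_sq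
    isSemialgebraicFunOn_one_sub_sq_half
  have hsqrt := IsSemialgebraicFunOn.sqrt_holds hp
  have h1 := isSemialgebraicFunOn_ratCast isSemialgebraic_unitIoo 1
  refine ((h1.div hsqrt) fun x hx => ?_).congr fun x _ => ?_
  · exact (Real.sqrt_pos.2 (radicand_pos hx)).ne'
  · simp [kFun]

/-- `x ↦ e(x₀)` is semialgebraic on `unitIoo`. [folklore] -/
theorem isSemialgebraicFunOn_eFun : IsSemialgebraicFunOn ℚ unitIoo (fun x => eFun (x 0)) := by
  have hn := IsSemialgebraicFunOn.sqrt_holds isSemialgebraicFunOn_one_sub_sq_half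
  have hd := IsSemialgebraicFunOn.sqrt_holds isSemialgebraicFunOn_one_sub_sq
  refine ((hn.div hd) fun x hx => ?_).congr fun x _ => ?_
  · exact (Real.sqrt_pos.2 (by have := hx.1; have := hx.2; nlinarith)).ne'
  · simp [eFun]

/-- `x ↦ g(x₀)` is semialgebraic on `unitIoo`. [folklore] -/
theorem isSemialgebraicFunOn_gFun : IsSemialgebraicFunOn ℚ unitIoo (fun x => gFun (x 0)) := by
  have hn := IsSemialgebraicFunOn.sqrt_holds isSemialgebraicFunOn_one_sub_sq
  have hd := IsSemialgebraicFunOn.sqrt_holds isSemialgebraicFunOn_one_sub_sq_half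
  refine ((hn.div hd) fun x hx => ?_).congr fun x _ => ?_
  · exact (Real.sqrt_pos.2 (by have := hx.1; have := hx.2; nlinarith)).ne'
  · simp [gFun]

/-- `k` is the tree's elliptic integrand of parameter `m = 1/2`. [folklore] -/
theorem kFun_eq_ellIntegrand (t : ℝ) :
    kFun t = Literature.Probability.RandomPlanarGeometry.ellIntegrand (1 / 2) t := by
  simp only [kFun, Literature.Probability.RandomPlanarGeometry.ellIntegrand]
  ring_nf

/-- `k` is integrable on `(0,1)` (singularity `(1−t)^{-1/2}` at `1`). [folklore] -/
theorem integrableOn_kFun : IntegrableOn kFun (Ioo 0 1) := by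
  have h := Literature.Probability.RandomPlanarGeometry.intervalIntegrable_ellIntegrand
    (m := 1 / 2) (by norm_num) (by norm_num)
  rw [intervalIntegrable_iff_integrableOn_Ioo_of_le zero_le_one] at h
  refine h.congr_fun (fun t _ => (kFun_eq_ellIntegrand t).symm) measurableSet_Ioo

/-- `e ≤ 1/√(1 − t²)` on `(0,1)`; `e` is integrable on `(0,1)`. [folklore] -/
theorem integrableOn_eFun : IntegrableOn eFun (Ioo 0 1) := by
  have h := Literature.Probability.RandomPlanarGeometry.intervalIntegrable_ellIntegrand
    (m := 0) le_rfl (by norm_num)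
  rw [intervalIntegrable_iff_integrableOn_Ioo_of_le zero_le_one] at h
  refine h.mono' ?_ ?_
  · refine ContinuousOn.aestronglyMeasurable ?_ measurableSet_Ioo
    refine ContinuousOn.div (by fun_prop) (by fun_prop) fun t ht => ?_
    exact (Real.sqrt_pos.2 (by nlinarith [ht.1, ht.2])).ne'
  · refine (ae_restrict_mem measurableSet_Ioo).mono fun t ht => ?_
    have h1 : 0 < 1 - t ^ 2 := by nlinarith [ht.1, ht.2]
    have hs : 0 < Real.sqrt (1 - t ^ 2) := Real.sqrt_pos.2 h1
    have hnum : Real.sqrt (1 - t ^ 2 / 2) ≤ 1 := by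
      rw [Real.sqrt_le_one]
      nlinarith [ht.1]
    unfold eFun
    rw [Real.norm_eq_abs, abs_of_nonneg (div_nonneg (Real.sqrt_nonneg _) hs.le),
      Literature.Probability.RandomPlanarGeometry.ellIntegrand, zero_mul, sub_zero, mul_one]
    exact div_le_div_of_nonneg_right hnum hs.le

/-- `g` is continuous on `[0,1]`, hence integrable on `(0,1)`. [folklore] -/
theorem integrableOn_gFun : IntegrableOn gFun (Ioo 0 1) := by
  have hc : ContinuousOn gFun (Icc 0 1) := by
    refine ContinuousOn.div (by fun_prop) (by fun_prop) fun t ht => ?_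
    exact (Real.sqrt_pos.2 (by nlinarith [ht.1, ht.2])).ne'
  exact (hc.integrableOn_compact isCompact_Icc).mono_set Ioo_subset_Icc_self

/-- `[(0,1), k]`, value `K(1/√2)`. [cite: Lawden1989, §3.1 eq. (3.1.3)] -/
def kRep : IntegralRep 1 := unitRep kFun isSemialgebraicFunOn_kFun integrableOn_kFun

/-- `[(0,1), e]`, value `E(1/√2)`. [cite: Lawden1989, §3.8 eq. (3.8.3)] -/
def eRep : IntegralRep 1 := unitRep eFun isSemialgebraicFunOn_eFun integrableOn_eFun

/-- `[(0,1), g]`, value `2E(1/√2) − K(1/√2)`. [folklore] -/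
def gRep : IntegralRep 1 := unitRep gFun isSemialgebraicFunOn_gFun integrableOn_gFun

/-- `value [(0,1), k] = K(1/√2) = lemniscaticK`. [cite: Lawden1989, §3.1 eq. (3.1.3)] -/
theorem kRep_value : kRep.value = Literature.Analysis.SpecialFunctions.lemniscaticK :=
  unitRep_value _ _ _

/-- `value [(0,1), e] = E(1/√2) = lemniscaticE`. [cite: Lawden1989, §3.8 eq. (3.8.3)] -/
theorem eRep_value : eRep.value = Literature.Analysis.SpecialFunctions.lemniscaticE :=
  unitRep_value _ _ _

/-- On `(0,1)`, `g = 2e − k`. [folklore] -/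
theorem gFun_eq {t : ℝ} (ht : t ∈ Ioo (0:ℝ) 1) : gFun t = 2 * eFun t - kFun t := by
  have h1 : 0 < 1 - t ^ 2 := by nlinarith [ht.1, ht.2]
  have h2 : 0 < 1 - t ^ 2 / 2 := by nlinarith [ht.1, ht.2]
  have hprod : Real.sqrt ((1 - t ^ 2) * (1 - t ^ 2 / 2)) =
      Real.sqrt (1 - t ^ 2) * Real.sqrt (1 - t ^ 2 / 2) := Real.sqrt_mul h1.le _
  unfold gFun eFun kFun
  rw [hprod]
  set a := Real.sqrt (1 - t ^ 2) with ha
  set b := Real.sqrt (1 - t ^ 2 / 2) with hb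
  have ha0 : 0 < a := Real.sqrt_pos.2 h1
  have hb0 : 0 < b := Real.sqrt_pos.2 h2
  have ha2 : a ^ 2 = 1 - t ^ 2 := Real.sq_sqrt h1.le
  have hb2 : b ^ 2 = 1 - t ^ 2 / 2 := Real.sq_sqrt h2.le
  field_simp
  linear_combination ha2 - 2 * hb2

/-- `value [(0,1), g] = 2E − K`. [folklore] -/
theorem gRep_value : gRep.value =
    2 * Literature.Analysis.SpecialFunctions.lemniscaticE - Literature.Analysis.SpecialFunctions.lemniscaticK := by
  rw [gRep, unitRep_value, setIntegral_congr_fun measurableSet_Ioo (fun t ht => gFun_eq ht),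
    integral_sub (integrableOn_eFun.const_mul 2) integrableOn_kFun, integral_const_mul]
  rfl

/-- The open unit square `(0,1)²` in the crux's typing. [folklore] -/
def unitSq : Set (Fin 2 → ℝ) := {x | ∀ i, x i ∈ Ioo (0:ℝ) 1}

/-- **The canonical left representation** `r₀ = [g] · [k] = [(0,1)², g(x₀)·k(x₁)]`, the Fubini
product of the two one-dimensional representations (value `(2E − K)·K`). [folklore] -/
def legendreRep : IntegralRep 2 := gRep.prod kRep

/-- Membership in the domain of `r₀`. [folklore] -/
theorem mem_legendreRep_domain (x : Fin 2 → ℝ) :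
    x ∈ legendreRep.domain ↔ x 0 ∈ Ioo (0:ℝ) 1 ∧ x 1 ∈ Ioo (0:ℝ) 1 := Iff.rfl

/-- The domain of `r₀` is the crux's `{x | ∀ i, x i ∈ (0,1)}`. [folklore] -/
theorem legendreRep_domain : legendreRep.domain = unitSq := by
  ext x
  rw [mem_legendreRep_domain]
  simp [unitSq, Fin.forall_fin_two]

/-- The integrand of `r₀` is `g(x₀)·k(x₁)`. [folklore] -/
theorem legendreRep_integrand_apply (x : Fin 2 → ℝ) :
    legendreRep.integrand x = gFun (x 0) * kFun (x 1) := by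
  rw [show legendreRep = gRep.prod kRep from rfl, IntegralRep.prod_integrand_eq]
  rfl

/-- **Value of `r₀`**: `(2E − K)·K = 2EK − K² = π/2` (Fubini `IntegralRep.value_prod` and the tree
theorem `Lawden1989_eq_3_8_29_lemniscatic_holds`, Legendre's relation at `k = k′ = 1/√2`).
[cite: Lawden1989, §3.8 eq. (3.8.29) and Ch. 3 Exercise 25] -/
theorem legendreRep_value : legendreRep.value = Real.pi / 2 := by
  rw [show legendreRep = gRep.prod kRep from rfl, IntegralRep.value_prod, gRep_value, kRep_value]
  have h := Literature.Analysis.SpecialFunctions.Lawden1989_eq_3_8_29_lemniscatic_holds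
  unfold Literature.Analysis.SpecialFunctions.Lawden1989_eq_3_8_29_lemniscatic at h
  linear_combination h

/-- The crux's integrand formula, verbatim. [folklore] -/
def cruxIntegrand (x : Fin 2 → ℝ) : ℝ :=
  2 * Real.sqrt (1 - x 0 ^ 2 / 2) / Real.sqrt (1 - x 0 ^ 2) / Real.sqrt ((1 - x 1 ^ 2) * (1 - x 1 ^ 2 / 2)) -
    1 / Real.sqrt ((1 - x 0 ^ 2) * (1 - x 0 ^ 2 / 2)) / Real.sqrt ((1 - x 1 ^ 2) * (1 - x 1 ^ 2 / 2))

/-- READBACK: on `(0,1)²` the crux's integrand is `(2e(x₀) − k(x₀))·k(x₁) = g(x₀)·k(x₁)`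
(left-associated divisions as printed). [folklore] -/
theorem cruxIntegrand_eq {x : Fin 2 → ℝ} (hx : x ∈ unitSq) :
    cruxIntegrand x = gFun (x 0) * kFun (x 1) := by
  rw [gFun_eq (hx 0)]
  unfold cruxIntegrand eFun kFun
  ring

/-- **The canonical right representation** `r₀' = [ℝ, 1/(2(1+x²))]` (value `π/2`). [folklore] -/
def arctanRep : IntegralRep 1 where
  domain := univ
  integrand := fun x => 1 / (2 * (1 + x 0 ^ 2))
  isSemialgebraic_domain := Literature.ModelTheory.ExponentialFields.isSemialgebraic_univ
  isSemialgebraicFunOn_integrand := by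
    have hu : IsSemialgebraic ℚ (univ : Set (Fin 1 → ℝ)) :=
      Literature.ModelTheory.ExponentialFields.isSemialgebraic_univ
    have h := isSemialgebraicFunOn_aeval_div_aeval hu
      (1 : MvPolynomial (Fin 1) ℚ) (2 * (1 + X 0 ^ 2)) (fun x _ => by
        simp only [map_mul, map_add, map_one, map_pow, MvPolynomial.aeval_X, map_ofNat]
        positivity)
    exact h.congr fun x _ => by
      simp only [map_mul, map_add, map_one, map_pow, MvPolynomial.aeval_X, map_ofNat]
  integrableOn := by
    rw [integrableOn_univ]
    have hg : Integrable (fun t : ℝ => 1 / (2 * (1 + t ^ 2))) := by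
      have := integrable_inv_one_add_sq.const_mul (1 / 2 : ℝ)
      refine this.congr (Filter.Eventually.of_forall fun t => ?_)
      simp only [one_div, mul_inv]
    exact ((volume_preserving_funUnique (Fin 1) ℝ).integrable_comp_emb
      (MeasurableEquiv.measurableEmbedding _)).mpr hg

/-- The domain of `r₀'`. [folklore] -/
@[simp] theorem arctanRep_domain : arctanRep.domain = univ := rfl

/-- The integrand of `r₀'`. [folklore] -/
@[simp] theorem arctanRep_integrand : arctanRep.integrand = fun x => 1 / (2 * (1 + x 0 ^ 2)) := rfl

/-- **Value of `r₀'`**: `∫_ℝ dx/(2(1+x²)) = π/2` (Mathlib `integral_univ_inv_one_add_sq`). [folklore] -/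
theorem arctanRep_value : arctanRep.value = Real.pi / 2 := by
  rw [IntegralRep.value, arctanRep_domain, Measure.restrict_univ, arctanRep_integrand]
  have h := (volume_preserving_funUnique (Fin 1) ℝ).integral_comp'
    (fun t : ℝ => 1 / (2 * (1 + t ^ 2)))
  simp only [MeasurableEquiv.funUnique] at h
  have h2 : ∫ t : ℝ, 1 / (2 * (1 + t ^ 2)) = Real.pi / 2 := by
    have : (fun t : ℝ => 1 / (2 * (1 + t ^ 2))) = fun t => (1 / 2 : ℝ) * (1 + t ^ 2)⁻¹ := by
      ext t
      simp only [one_div, mul_inv]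
    rw [this, integral_const_mul, integral_univ_inv_one_add_sq]
    ring
  rw [← h2, ← h]
  rfl

/-- NO EVALUATION KILL: the two canonical representations have the same value `π/2`
(so no additive invariant factoring through `KZ.eval` separates them). [folklore] -/
theorem legendreRep_value_eq_arctanRep_value : legendreRep.value = arctanRep.value := by
  rw [legendreRep_value, arctanRep_value]

/-- **Off-domain values and the `∀`-shape are harmless**: two representations with the same
domain whose integrands agree on it are equivalent — by ONE change of variables along the identity
(re-derivation of refuter g8-4's lemma of 2026-08-13, ledger note on the item). [folklore] -/
theorem equivalent_of_eqOn {n : ℕ} (r r' : IntegralRep n) (hd : r'.domain = r.domain)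
    (hf : EqOn r.integrand r'.integrand r.domain) : Equivalent r r' := by
  apply changeOfVariablesRel_subset_relations
  refine ⟨n, r, r', id, fun _ => ContinuousLinearMap.id ℝ _, isSemialgebraicMapOn_id r.isSemialgebraic_domain,
    fun x _ => hasFDerivWithinAt_id x _, injOn_id _, by simp [hd], ?_, rfl⟩
  intro x hx
  have : (ContinuousLinearMap.id ℝ (Fin n → ℝ)).det = 1 := by simp [ContinuousLinearMap.det]
  simp [hf hx, this]

/-- **Reduction to the canonical pair.** The crux is equivalent to its single instance
`[r₀] − [r₀'] ∈ KZ.relations`: every admissible `(r, r')` differs from `(r₀, r₀')` by identity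
moves (`equivalent_of_eqOn`), and conversely `(r₀, r₀')` is admissible. In particular the
hypotheses are satisfiable (NO VACUITY) and the `∀ r r'` shape adds nothing. [folklore] -/
theorem gpcLegendre_iff : GpcLegendreLemniscatic ↔ Equivalent legendreRep arctanRep := by
  constructor
  · intro h
    refine h legendreRep arctanRep legendreRep_domain (fun x hx => ?_) rfl (fun x _ => rfl)
    rw [legendreRep_domain] at hx
    exact (legendreRep_integrand_apply x).trans (cruxIntegrand_eq hx).symm
  · intro h r r' hd hf hd' hf'
    have h1 : Equivalent r legendreRep := by
      refine equivalent_of_eqOn r legendreRep (legendreRep_domain.trans hd.symm) fun x hx => ?_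
      have hx' : x ∈ unitSq := by rw [hd] at hx; exact hx
      rw [legendreRep_integrand_apply, ← cruxIntegrand_eq hx']
      exact hf hx
    have h2 : Equivalent arctanRep r' := by
      refine equivalent_of_eqOn arctanRep r' (show r'.domain = arctanRep.domain from hd') fun x _ => ?_
      have hx : x ∈ r'.domain := by rw [hd']; trivial
      show arctanRep.integrand x = r'.integrand x
      exact (hf' hx).symm
    exact h1.trans (h.trans h2)

/-! ## §5 Why it resists: the crux is a CONSEQUENCE of the summit statement

`r₀'` has KZ's literal rational shape, and `r₀` is equivalent to SOME rational representation by
the tree theorem `KZ.exists_isRational_equivalent_holds` ("algebraic integrands give the same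
periods", KZ §1.1, proved via Tarski–Seidenberg); values agree (`legendreRep_value_eq_arctanRep_value`,
i.e. Legendre's relation, proved). Hence Conjecture 1 as typed (`KontsevichZagierPeriods`) IMPLIES the
crux. Contrapositive: **a refutation of this crux would refute the summit statement itself** — the
only possible weapon is a new additive invariant of the full four-move calculus vanishing on
`KZ.relations` and separating two representations of equal value, i.e. a disproof of the
Kontsevich–Zagier period conjecture in this calculus. No cheap kill exists. -/

/-- `r₀' = [ℝ, 1/(2(1+x²))]` has KZ's literal rational shape. [cite: KontsevichZagier2001, §1.1 Definition] -/
theorem arctanRep_isRational : arctanRep.IsRational := by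
  refine ⟨1, 2 * (1 + X 0 ^ 2), fun x _ => ?_, fun x _ => ?_⟩
  · simp only [map_mul, map_add, map_one, map_pow, MvPolynomial.aeval_X, map_ofNat]
    positivity
  · simp only [arctanRep_integrand, map_mul, map_add, map_one, map_pow, MvPolynomial.aeval_X, map_ofNat]

/-- **A refutation of the crux would refute the summit** (`¬ crux → ¬ KontsevichZagierPeriods`, the
route's KILL CRITERION made formal): by `exists_isRational_equivalent_holds`, soundness and the
proved value identity, Conjecture 1 for RATIONAL representations already forces `[r₀] ~ [r₀']`.
(Stated contrapositively on purpose: the positive form `KontsevichZagierPeriods → crux` is a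
conditional proof and must not be read as closing the item.) [folklore] -/
theorem not_kontsevichZagierPeriods_of_not_gpcLegendre (hneg : ¬ GpcLegendreLemniscatic) :
    ¬ KontsevichZagierPeriods := by
  intro h
  apply hneg
  rw [gpcLegendre_iff]
  obtain ⟨m, r₁, hr₁, he⟩ := exists_isRational_equivalent_holds legendreRep
  have hv : r₁.value = arctanRep.value :=
    (Equivalent.value_eq_holds he).symm.trans legendreRep_value_eq_arctanRep_value
  have h' : Equivalent r₁ arctanRep := h r₁ arctanRep hr₁ arctanRep_isRational hv
  exact he.trans h'

end Summit.KontsevichZagierPeriods.Grothendieck.GpcLegendreLemniscaticNegative
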